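import Literature.MathematicalPhysics.QuantumFieldTheory.Balaban1983to89.B2Prop31ZeroFieldConcrete

/-!
# `Balaban1983to89.B2Prop31ZeroFieldConcreteFamily` — [Balaban1982Higgs2] Proposition 3.1 p. 589: the cell's VERBATIM-TYPED
`B2.Prop31Printed` INHABITED by the ZERO-FIELD INSTANCES OF THE CONCRETE (3.23)/(3.24)/(3.25) CARRIER — every field of the
instance record is the concrete object of the p15 files (`form` = `form325 … 0 …` = ⟨Φ, Δ(0)Φ⟩ of (3.25) p252464, `formN` =
`form325N` = ⟨Φ, Δ′(0)Φ⟩ of (3.27) p254057, `term k` = the k-th term of (3.28) p254943, `bond k`/`mass k` = the printed sums of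
(3.26) at `U ≡ 1`), and both conjuncts of `B2.Prop31Printed` hold with `γ₀ = min(a(1 − L⁻²)/(8d + 2m²), 1/4)` and error constant
`C = 0` by `B2Prop31ZeroFieldConcrete.prop31_zeroField_concrete`

statement-level skeleton of published theorems with citation tags; proofs where landed; nothing here is a claim about the Yang–Mills mass gap

CITATION HEADER.  T. Bałaban, *(Higgs)₂,₃ quantum fields in a finite volume. II. An upper bound*, Commun. Math. Phys. **86**
(1982) 555–594 [Balaban1982Higgs2], Prop. 3.1 (3.26) p. 589 (PDF held `paper:balaban1982-cmp86-higgs23-ii`; p. 589 [PDF 35] READ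
AS IMAGE on the ×2 render `run/shared/lean/pub/pub-balaban/b2b-balaban-ref1/pages/1982-cmp86-higgs23-II/1982-cmp86-higgs23-II-p035-x2.png`).
Unit `lit-balaban-p15` gen 4, target 3, file 3 (Phase-2 proof seat p15; HOME `run/shared/lean/pub/lit-balaban/`).  SKELETON row
**B2.Prop3.1** (decl of record `B2.Prop31Printed`, cell pub-balaban unit pv07; owner r02).  The ℤ^{d+1}-carrier twin is r14's
`B2Prop31ZeroField.prop31Printed_zeroField` (family `ZMulti`, (3.27)/(3.28) carried as instance data); here the instances ARE
the concrete objects for which (3.25), (3.27), (3.28) are theorems.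

WHAT IS PRINTED (p. 589, the clause inhabited): *"There exists a constant γ₀ > 0 dependent on the space dimension d and the
constant a only, and independent of ε and a choice of the sets Λ₅⁽⁰⁾, …, Λ₅⁽ᴷ⁻¹⁾, such that … (3.26) … If Ã^ε = 0, then the
inequality holds without the last sum on the right side and without any restrictions on the configuration Φ."*

WHAT THIS MODULE PROVES (kernel-checked, 0 `sorry`, standard axioms): `ZFIdx` (index of the zero-field instances: `K ≤` the number of
scales, `Lᴷε ≤ 1`, nested region data `R`, a configuration `Φ` of (3.24)), `volK` (`|Λ_k|`), `concreteZeroFam` (the instance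
record, `restricted := True`, `zeroField := True`), **`prop31Printed_concreteZeroField`**: `B2.Prop31Printed PB (concreteZeroFam C PB.a m²)`
for every parameter record `PB` with `PB.a > 0`, every lattice family with `L > 1`, every `m² > 0`, charge data `C` and `N`.
HONEST SCOPE.  Zero vector field only (both conjuncts are the zero-field inequality, the «restricted» one with `C = 0` — the
strongest reading, as in `B2Prop31ZeroField`); `PB.L`, `PB.κ₀` enter `B2.Prop31Printed` only through the vanishing error term
(intended `PB.L = P.L`); nothing for `Ã ≠ 0`.
-/

noncomputable section

open MeasureTheory Finset Real
open scoped BigOperators ENNReal InnerProductSpace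

namespace Literature.MathematicalPhysics.QuantumFieldTheory.Balaban1983to89.B2Prop31ZeroFieldConcreteFamily

open Literature.MathematicalPhysics.QuantumFieldTheory.Balaban1983to89.HiggsLattice
open Literature.MathematicalPhysics.QuantumFieldTheory.Balaban1983to89.HiggsAveraging
open Literature.MathematicalPhysics.QuantumFieldTheory.Balaban1983to89.HiggsCovariance
open Literature.MathematicalPhysics.QuantumFieldTheory.Balaban1983to89.B2Eq337ScalarIntegration
open Literature.MathematicalPhysics.QuantumFieldTheory.Balaban1983to89.B2Eq325ConcreteSchur
open Literature.MathematicalPhysics.QuantumFieldTheory.Balaban1983to89.B2Ineq327ConcreteNeumann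
open Literature.MathematicalPhysics.QuantumFieldTheory.Balaban1983to89.B2Eq328ConcretePieces
open Literature.MathematicalPhysics.QuantumFieldTheory.Balaban1983to89.B2Prop31ZeroFieldConcrete

variable {P : HiggsLattice.Params} {N : ℕ}

/-- Index of ONE zero-field instance of Proposition 3.1 on the concrete carrier: the number of scales `K` (`≤` that of the
lattice family, with the stopping rule `Lᴷε ≤ 1`), nested region data `R` ((3.23)/(3.24)) and a configuration `Φ` of (3.24).
[cite: Balaban1982Higgs2, Prop. 3.1 (3.26) p.589] -/
structure ZFIdx (P : HiggsLattice.Params) (N : ℕ) where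
  /-- the number of renormalization steps -/
  K : ℕ
  /-- `K ≤` the number of scales of the lattice family -/
  hK : K ≤ P.K
  /-- the stopping rule `Lᴷε ≤ 1` -/
  hε : P.mesh K ≤ 1
  /-- the region data `Λ₅⁽⁰⁾`, `Λ_1, …, Λ_K` -/
  R : Regions P K
  /-- the nested geometry `Λ₅⁽⁰⁾ = ⨆_k Bᵏ(Λ_k)` -/
  hR : Nested R
  /-- the configuration `Φ` of (3.24) -/
  Φ : Cfg R N

/-- `|Λ_k|`, the number of points of the k-th region (`k = 1, …, K`; `0` otherwise). [cite: Balaban1982Higgs2, Prop. 3.1 (3.26) p.589] -/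
def volK {K : ℕ} (R : Regions P K) (k : ℕ) : ℕ :=
  if h : 0 < k ∧ k ≤ K then (R.block ⟨k - 1, by omega⟩).card else 0

/-- **The zero-field instances of `B2.P31Setting` on the concrete carrier**: `ε` the lattice spacing, `K`, `restricted := True`,
`zeroField := True`, `form = ⟨Φ, Δ(0)Φ⟩ = form325`, `formN = ⟨Φ, Δ′(0)Φ⟩ = form325N`, `term k` = the k-th term of (3.28)
(`outTerm` / `termForm`), `bond k`, `mass k` = the printed sums of (3.26) at `U ≡ 1` (`bond0`/`bondK`, `mass0`/`massK`), `vol k = |Λ_k|`.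
[cite: Balaban1982Higgs2, Prop. 3.1 (3.26)–(3.28) p.589] -/
def concreteZeroFam (C : ChargeData N) (a msq : ℝ) (i : ZFIdx P N) : B2.P31Setting where
  ε := P.ε
  K := i.K
  restricted := True
  zeroField := True
  form := form325 i.R C a (0 : HiggsLattice.VecField P 0) msq i.Φ
  formN := form325N i.R C a i.hR.pieces (0 : HiggsLattice.VecField P 0) msq i.Φ
  term := natExt (outTerm i.R C (0 : HiggsLattice.VecField P 0) msq i.Φ.1)
    fun j => termForm i.R C a (0 : HiggsLattice.VecField P 0) msq j (resL i.R j i.Φ)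
  bond := natExt (bond0 i.R C (0 : HiggsLattice.VecField P 0) i.Φ.1) fun j => bondK i.R j (resL i.R j i.Φ)
  mass := natExt (mass0 i.R msq i.Φ.1) fun j => massK i.R msq j (resL i.R j i.Φ)
  vol := volK i.R

/-- (3.27) holds field-by-field in every instance (p254057). [cite: Balaban1982Higgs2, (3.27) p.589] -/
theorem concreteZeroFam_formN_le (C : ChargeData N) {a msq : ℝ} (ha : 0 < a) (hL : 1 < P.L) (hmsq : 0 < msq)
    (i : ZFIdx P N) : (concreteZeroFam C a msq i).formN ≤ (concreteZeroFam C a msq i).form :=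
  ineq327_concrete i.R C i.hR.pieces (0 : HiggsLattice.VecField P 0) ha hL hmsq i.Φ

/-- (3.28) holds field-by-field in every instance (p254943). [cite: Balaban1982Higgs2, (3.28) p.589] -/
theorem concreteZeroFam_formN_eq (C : ChargeData N) {a msq : ℝ} (ha : 0 < a) (hL : 1 < P.L) (hmsq : 0 < msq)
    (i : ZFIdx P N) :
    (concreteZeroFam C a msq i).formN = ∑ k ∈ Finset.range (i.K + 1), (concreteZeroFam C a msq i).term k := by
  show form325N i.R C a i.hR.pieces (0 : HiggsLattice.VecField P 0) msq i.Φ = _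
  rw [concreteZeroFam, sum_range_natExt]
  exact eq328_concrete i.R C (0 : HiggsLattice.VecField P 0) i.hR ha hL hmsq.le i.Φ

/-- **THE CELL'S TYPED PROPOSITION 3.1 `B2.Prop31Printed` HOLDS ON THE ZERO-FIELD INSTANCES OF THE CONCRETE CARRIER** (both
conjuncts, error constant `C = 0`), `γ₀ = min(a(1 − L⁻²)/(8d + 2m²), 1/4)`, for every parameter record `PB` with `PB.a > 0`,
every lattice family with `L > 1`, every `m² > 0`. [cite: Balaban1982Higgs2, Prop. 3.1 (3.26) p.589] -/
theorem prop31Printed_concreteZeroField (PB : B2.Params) (C : ChargeData N) {msq : ℝ} (ha : 0 < PB.a) (hL : 1 < P.L)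
    (hmsq : 0 < msq) : B2.Prop31Printed PB (concreteZeroFam (P := P) C PB.a msq) := by
  refine ⟨gamma0 P PB.a msq, 0, gamma0_pos ha hL hmsq.le, le_rfl, fun i _ => ?_, fun i _ => ?_⟩
  · have h := prop31_zeroField_concrete i.R C i.hR i.hK i.hε ha hL hmsq i.Φ
    simp only [zero_mul, Finset.sum_const_zero, sub_zero]
    dsimp only [concreteZeroFam]
    rw [sum_range_natExt, sum_range_natExt]
    exact h
  · have h := prop31_zeroField_concrete i.R C i.hR i.hK i.hε ha hL hmsq i.Φ
    dsimp only [concreteZeroFam]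
    rw [sum_range_natExt, sum_range_natExt]
    exact h

end Literature.MathematicalPhysics.QuantumFieldTheory.Balaban1983to89.B2Prop31ZeroFieldConcreteFamily
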